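import Summits.HodgeConjecture.HodgeConjecture.Theorems.F0P3KitOfRecord              -- ★ p822184 (p04 (g7), K0): `kitOfRecord`, `XiSide`, `GHSide`, `cptXi₀` (+ ★ V6-A kit, ★ K6 arch data)
import Summits.HodgeConjecture.HodgeConjecture.Theorems.F0P3ClassificationLawsV6     -- ★ p822130 (V6-B): the law texts `XiFamilyFin`, `XiUnram`, `EvpConvention`
import Summits.HodgeConjecture.HodgeConjecture.Theorems.F0P3XiEvpOfRecord            -- ★ p820295 (p01 (g7)): `xiEvpOfRecord`, `xiUnram_xiEvpOfRecord`, `evpConvention_xi_xiEvpOfRecord` (+ ★ p819611∕p819729∕p820148)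
import HarnessLib

/-!
# THE ξ-SIDE OF RECORD `ξd₀ = xiSideOfRecord …` for the kit of record `𝔠₀ = kitOfRecord …`, and the laws `XiFamilyFin` ∕ `XiUnram` ∕ `EvpConvention` AT IT

Cell `hodgecm-mathlib`, F0∕P3 «U3-mult», crux H413 (`stmt-HodgeConjecture-24833`), rung 4; F0P3-p01 (g8), PLAN.F0P3g5 §5 **K2 ξ-share** (F0P3-plan (g5) GO 11:58:29Z).
DEF LANE: ONE definition (`xiSideOfRecord`) + `rfl` read-backs + theorems; no instance, no notation, no named fact, no `sorry`.

K0 (★ p822184 `kitOfRecord`) takes the ξ-indexed data as ONE parameter `ξd : XiSide L H 𝔰.PacketG 𝔰.PacketH` (fields `evpG evpH ramG ramH PiXi ρXi ram tXi packFin`).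
This file builds THE `ξd` OF RECORD: the (J2) packet data `evpG evpH ramG ramH PiXi ρXi` stay PARAMETERS (T1∕F0P3a export), and the ξ-LOCAL FAMILY OF RECORD at the
finite places is plugged from the ★ closed forms of p01 (g7) (`MEMO-K0-xi-fields` §2):
* `ram := fun ξ => ramOfRecord₂ L H hH hHd μω μZ keys ξ (hexc ξ)` (★ p819729) — `hexc` any proof of the cofinite sphericity of the Keys member (proof-irrelevant;
  of record: `hexc₀ ξ := hexc_of_xiPinSphericalCofinite L μω hμu μZ keys hquad hLi ξ` from the letter (L-i′) ★ `XiPinSphericalCofinite` = books row #79);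
* `tXi := xiEvpOfRecord L H hH hHd μω hμu Δ mH mG νG νH ξloc μZ keys hCM μv` (★ p820295, eigencharacter currency at the kit's Haar family `μv`);
* `packFin := xiPacketFamilyOfRecord L H hH hHd μω hμu Δ mH mG νG νH ξloc μZ keys hCM` (★ p819611).
`hH hHd` are ANY proofs of «`H` hermitian» ∕ «`det H` a unit» (at the frame: ★ `transpose_map_cmConjRingHom_eq_of_frame`, ★ `isUnit_det_of_frame` — Props, so law #20 matches
v6 `XiFamilyFin`'s frame terms by proof irrelevance); `keys`, `hCM` of record are `keysOfKeysCaseTwo …` ∕ `hCM_of_cmCharIdentityPackage …` (★ p820148) — binders here.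
INSTANCE PLUMBING: the σ-algebra on `G′_v = (cmDatum L 3 H).Local v` is FIXED to `borel _` (the kit's `μv v : @Measure _ (borel _)`, v6 `XiUnram`'s `letI`), by `letI`
families inside the binder types and bodies — exactly ★ p819116's idiom; the five other measurable-space families (on `H_v`, the centraliser quotients, `PGL`-quotient of
`U(Φ₃)_v`) stay GENERIC instance binders, to be T1's at K9.

THE THREE ξ-LAWS AT `𝔠₀ := kitOfRecord … (xiSideOfRecord …) …` (K7's `h20 h21 h23`):
* **`xiFamilyFin_kitOfRecord : 𝔠₀.XiFamilyFin μω hμu`** — row #20, a THEOREM (★ `isXiLocalFamily_xiPacketFamilyOfRecord`);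
* **`xiUnram_kitOfRecord (hμv) : 𝔠₀.XiUnram`** — row #21 at any `hexc` (★ `xiUnram_xiEvpOfRecord`), and **`xiUnram_kitOfRecord_of_xiPinSphericalCofinite (hquad) (hLi) (hμv)`**
  — the same with the letter (L-i′) `hLi : XiPinSphericalCofinite L` BY NAME (`hμv` : the kit's `μv v` are Haar = pin (iii) data);
* **`evpConvention_kitOfRecord (hG) (hH') : 𝔠₀.EvpConvention`** — row #23: the ξ-conjunct is a THEOREM (★ `evpConvention_xi_xiEvpOfRecord`), the two packet-side junk
  clauses `hG hH'` are (J2)∕P3a-pin hypotheses on the parameters `evpG evpH`.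

References: [Rogawski1990] §12.2 (2) pp. 173–174, §13.1 p. 199, §13.3 Thm. 13.3.6 (b) p. 202, §13.7 p. 206, §14.6 pp. 236–244; [CartierCorvallis1979] §IV.1 Cor. 4.1.
HC_CM is proved only modulo the printed citations until rung 0 closes.
-/

set_option autoImplicit false
set_option linter.dupNamespace false

noncomputable section

open NumberField IsDedekindDomain MeasureTheory
open Literature.NumberTheory.Rogawski1990 Literature.NumberTheory.GaloisRepresentations
open Literature.NumberTheory.Automorphic Literature.NumberTheory.Automorphic.UnitaryGroup
open scoped Matrix

namespace Summit.HodgeConjecture.HodgeConjecture.Cruxes.H413.F0P3XiSideOfRecord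

open Summit.HodgeConjecture.HodgeConjecture.Cruxes.H413.F0P3InnerFormClassificationV6
open Summit.HodgeConjecture.HodgeConjecture.Cruxes.H413.F0P3KitOfRecord (kitOfRecord XiSide GHSide)
open Summit.HodgeConjecture.HodgeConjecture.Cruxes.H413.F0P3XiPacketFamilyOfRecord

variable (L : Type) [Field L] [NumberField L] [IsCMField L] (H : Matrix (Fin 3) (Fin 3) L)

/-! ## §1 The binders of the ξ-local family of record (`MEMO-K0-xi-fields` §0) -/

variable (hH : (H.map (cmConjRingHom L))ᵀ = H) (hHd : IsUnit H.det) (μω : HeckeCharacter L) (hμu : μω.IsUnitary)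
  [∀ v : HeightOneSpectrum (𝓞 ↥(maximalRealSubfield L)),
    MeasurableSpace ((cmDatum L 2 (Matrix.of fun i j : Fin 2 => if i.val + j.val + 1 = 2 then (1 : L) else 0)).Local v ×
      (cmDatum L 1 (Matrix.of fun i j : Fin 1 => if i.val + j.val + 1 = 1 then (1 : L) else 0)).Local v)]
  [∀ (v : HeightOneSpectrum (𝓞 ↥(maximalRealSubfield L)))
      (a : ((cmDatum L 2 (Matrix.of fun i j : Fin 2 => if i.val + j.val + 1 = 2 then (1 : L) else 0)).Local v ×
        (cmDatum L 1 (Matrix.of fun i j : Fin 1 => if i.val + j.val + 1 = 1 then (1 : L) else 0)).Local v)),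
    MeasurableSpace (((cmDatum L 2 (Matrix.of fun i j : Fin 2 => if i.val + j.val + 1 = 2 then (1 : L) else 0)).Local v ×
        (cmDatum L 1 (Matrix.of fun i j : Fin 1 => if i.val + j.val + 1 = 1 then (1 : L) else 0)).Local v) ⧸
      Subgroup.centralizer ({a} : Set ((cmDatum L 2 (Matrix.of fun i j : Fin 2 => if i.val + j.val + 1 = 2 then (1 : L) else 0)).Local v ×
        (cmDatum L 1 (Matrix.of fun i j : Fin 1 => if i.val + j.val + 1 = 1 then (1 : L) else 0)).Local v)))]
  [∀ (v : HeightOneSpectrum (𝓞 ↥(maximalRealSubfield L))) (γ : (cmDatum L 3 H).Local v),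
    MeasurableSpace ((cmDatum L 3 H).Local v ⧸ Subgroup.centralizer ({γ} : Set ((cmDatum L 3 H).Local v)))]
  [∀ v : HeightOneSpectrum (𝓞 ↥(maximalRealSubfield L)), MeasurableSpace (Gqs L v ⧸ Subgroup.center (Gqs L v))]
  (Δ : ∀ v : HeightOneSpectrum (𝓞 ↥(maximalRealSubfield L)), LocalTransferFactor L H v)
  (mH : ∀ v : HeightOneSpectrum (𝓞 ↥(maximalRealSubfield L)),
    OrbitalMeasureFamily ((cmDatum L 2 (Matrix.of fun i j : Fin 2 => if i.val + j.val + 1 = 2 then (1 : L) else 0)).Local v ×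
      (cmDatum L 1 (Matrix.of fun i j : Fin 1 => if i.val + j.val + 1 = 1 then (1 : L) else 0)).Local v))
  (mG : ∀ v : HeightOneSpectrum (𝓞 ↥(maximalRealSubfield L)), letI : MeasurableSpace ((cmDatum L 3 H).Local v) := borel _; OrbitalMeasureFamily ((cmDatum L 3 H).Local v))
  (νG : ∀ v : HeightOneSpectrum (𝓞 ↥(maximalRealSubfield L)), @Measure ((cmDatum L 3 H).Local v) (borel _))
  (νH : ∀ v : HeightOneSpectrum (𝓞 ↥(maximalRealSubfield L)),
    Measure ((cmDatum L 2 (Matrix.of fun i j : Fin 2 => if i.val + j.val + 1 = 2 then (1 : L) else 0)).Local v ×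
      (cmDatum L 1 (Matrix.of fun i j : Fin 1 => if i.val + j.val + 1 = 1 then (1 : L) else 0)).Local v))
  (ξloc : OneDimAutRepH L → ∀ v : HeightOneSpectrum (𝓞 ↥(maximalRealSubfield L)),
    (cmDatum L 2 (Matrix.of fun i j : Fin 2 => if i.val + j.val + 1 = 2 then (1 : L) else 0)).Local v ×
      (cmDatum L 1 (Matrix.of fun i j : Fin 1 => if i.val + j.val + 1 = 1 then (1 : L) else 0)).Local v →* ℂˣ)
  (μZ : ∀ v : HeightOneSpectrum (𝓞 ↥(maximalRealSubfield L)), Measure (Gqs L v ⧸ Subgroup.center (Gqs L v)))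
  (keys : ∀ (ξ : OneDimAutRepH L) (v : HeightOneSpectrum (𝓞 ↥(maximalRealSubfield L))),
    (∀ w : PlacesOver L v, IsCMField.complexConj L • w.1 = w.1) →
      {p : IrrClass (Gqs L v) × IrrClass (Gqs L v) //
        KeysCaseTwoLabels L v (μω.semilocalComponent L v) (torusLocalComponent L (IsCMField.complexConj L) v ξ.η)
          (torusLocalComponent L (IsCMField.complexConj L) v ξ.ψ) p.1 p.2 ∧
        p.1.IsSquareIntegrable (μZ v) ∧ ¬ p.2.IsSquareIntegrable (μZ v)})
  (hCM : letI : ∀ v : HeightOneSpectrum (𝓞 ↥(maximalRealSubfield L)), MeasurableSpace ((cmDatum L 3 H).Local v) := fun _ => borel _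
    ∀ (ξ : OneDimAutRepH L) (v : HeightOneSpectrum (𝓞 ↥(maximalRealSubfield L)))
    (hns : ∀ w : PlacesOver L v, IsCMField.complexConj L • w.1 = w.1)
    (T : GL (Fin 3) (LocalRing L v)) (a : LocalRing L v) (ha : IsUnit a)
    (h : formCongr (conjLocal L (IsCMField.complexConj L) v) T (H.map (algebraMap L (LocalRing L v))) =
      a • (Matrix.of fun i j : Fin 3 => if i.val + j.val + 1 = 3 then (1 : L) else 0).map (algebraMap L (LocalRing L v)))
    (π2 πn : IrrClass (Gqs L v)),
    KeysCaseTwoLabels L v (μω.semilocalComponent L v) (torusLocalComponent L (IsCMField.complexConj L) v ξ.η)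
      (torusLocalComponent L (IsCMField.complexConj L) v ξ.ψ) π2 πn → ¬ πn.IsSquareIntegrable (μZ v) →
    CMNonsplitCharIdentityAt L v H (Δ v) (mH v) (mG v) (νG v) (νH v) (ξloc ξ v) (IrrClass.comap (cmDatumLocalCongr L v T ha h).symm πn))
  (hexc : ∀ ξ : OneDimAutRepH L, ∀ᶠ v : HeightOneSpectrum (𝓞 ↥(maximalRealSubfield L)) in Filter.cofinite,
      ∀ hns : ∀ w : PlacesOver L v, IsCMField.complexConj L • w.1 = w.1,
        ((keys ξ v hns).1.2).IsSpherical (cmLocalIntegralLevel L 3 (qsForm L) v))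
  (μv : ∀ v : Places L, @Measure ((cmDatum L 3 H).Local v) (borel _))
  {PG PH : Type} (evpG : PG → EvpData L H) (evpH : PH → EvpData L H) (ramG : PG → Finset (Places L)) (ramH : PH → Finset (Places L))
  (PiXi : OneDimAutRepH L → PG) (ρXi : OneDimAutRepH L → PH)

/-! ## §2 `ξd₀ = xiSideOfRecord …` -/

/-- **`xiSideOfRecord … : XiSide L H PG PH` — THE ξ-SIDE OF RECORD** for K0's `kitOfRecord`: (J2) packet data `evpG evpH ramG ramH PiXi ρXi` as given;
`ram := ramOfRecord₂ … (hexc ξ)`, `tXi := xiEvpOfRecord … μv`, `packFin := xiPacketFamilyOfRecord …` (★ p819729 ∕ p820295 ∕ p819611).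
[cite: Rogawski1990, §12.2 (2) pp. 173–174; §13.1 p. 199; §13.7 p. 206] -/
def xiSideOfRecord : XiSide L H PG PH :=
  letI : ∀ v : HeightOneSpectrum (𝓞 ↥(maximalRealSubfield L)), MeasurableSpace ((cmDatum L 3 H).Local v) := fun _ => borel _
  { evpG := evpG, evpH := evpH, ramG := ramG, ramH := ramH, PiXi := PiXi, ρXi := ρXi
    ram := fun ξ => ramOfRecord₂ L H hH hHd μω μZ keys ξ (hexc ξ)
    tXi := xiEvpOfRecord L H hH hHd μω hμu Δ mH mG νG νH ξloc μZ keys hCM μv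
    packFin := xiPacketFamilyOfRecord L H hH hHd μω hμu Δ mH mG νG νH ξloc μZ keys hCM }

/-- `ξd₀.ram ξ = ramOfRecord₂ … ξ (hexc ξ)`. [cite: Rogawski1990, §13.3 Thm. 13.3.6 (b) p. 202] -/
theorem xiSideOfRecord_ram (ξ : OneDimAutRepH L) :
    (xiSideOfRecord L H hH hHd μω hμu Δ mH mG νG νH ξloc μZ keys hCM hexc μv evpG evpH ramG ramH PiXi ρXi).ram ξ =
      ramOfRecord₂ L H hH hHd μω μZ keys ξ (hexc ξ) :=
  rfl

/-- `ξd₀.tXi = xiEvpOfRecord … μv`. [cite: Rogawski1990, §13.7 p. 206] -/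
theorem xiSideOfRecord_tXi :
    (xiSideOfRecord L H hH hHd μω hμu Δ mH mG νG νH ξloc μZ keys hCM hexc μv evpG evpH ramG ramH PiXi ρXi).tXi =
      (letI : ∀ v : HeightOneSpectrum (𝓞 ↥(maximalRealSubfield L)), MeasurableSpace ((cmDatum L 3 H).Local v) := fun _ => borel _
       xiEvpOfRecord L H hH hHd μω hμu Δ mH mG νG νH ξloc μZ keys hCM μv) :=
  rfl

/-- `ξd₀.packFin = xiPacketFamilyOfRecord …`. [cite: Rogawski1990, §13.1 p. 199] -/
theorem xiSideOfRecord_packFin :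
    (xiSideOfRecord L H hH hHd μω hμu Δ mH mG νG νH ξloc μZ keys hCM hexc μv evpG evpH ramG ramH PiXi ρXi).packFin =
      (letI : ∀ v : HeightOneSpectrum (𝓞 ↥(maximalRealSubfield L)), MeasurableSpace ((cmDatum L 3 H).Local v) := fun _ => borel _
       xiPacketFamilyOfRecord L H hH hHd μω hμu Δ mH mG νG νH ξloc μZ keys hCM) :=
  rfl

/-- The (J2) packet data pass through unchanged: `ξd₀.PiXi = PiXi`. [cite: Rogawski1990, §13.1 p. 199] -/
theorem xiSideOfRecord_PiXi : (xiSideOfRecord L H hH hHd μω hμu Δ mH mG νG νH ξloc μZ keys hCM hexc μv evpG evpH ramG ramH PiXi ρXi).PiXi = PiXi := rfl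

/-- `ξd₀.ρXi = ρXi`. [cite: Rogawski1990, §13.1 p. 199] -/
theorem xiSideOfRecord_ρXi : (xiSideOfRecord L H hH hHd μω hμu Δ mH mG νG νH ξloc μZ keys hCM hexc μv evpG evpH ramG ramH PiXi ρXi).ρXi = ρXi := rfl

/-- `ξd₀.evpG = evpG`. [cite: Rogawski1990, §13.7 p. 206] -/
theorem xiSideOfRecord_evpG : (xiSideOfRecord L H hH hHd μω hμu Δ mH mG νG νH ξloc μZ keys hCM hexc μv evpG evpH ramG ramH PiXi ρXi).evpG = evpG := rfl

/-- `ξd₀.evpH = evpH`. [cite: Rogawski1990, §13.7 p. 206] -/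
theorem xiSideOfRecord_evpH : (xiSideOfRecord L H hH hHd μω hμu Δ mH mG νG νH ξloc μZ keys hCM hexc μv evpG evpH ramG ramH PiXi ρXi).evpH = evpH := rfl

/-! ## §3 The three ξ-laws AT `𝔠₀ = kitOfRecord … ξd₀ …` -/

section Laws

variable (ι : L →+* ℂ) (T : GL (Fin 3) ℂ)
  (hT : (T : Matrix (Fin 3) (Fin 3) ℂ)ᴴ * H.map ι * (T : Matrix (Fin 3) (Fin 3) ℂ) = Literature.Geometry.ComplexHyperbolic.BallModel.J)
  (μ : Measure (Gp L H).automorphicQuotient) [(Gp L H).IsAutomorphicMeasure μ]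
  [MeasurableSpace (Gp L H).Adelic] [BorelSpace (Gp L H).Adelic]
  (𝔰 : Sockets L H μ) (gh : GHSide L H ι T hT 𝔰.PacketG 𝔰.PacketH)
  (evpG' : 𝔰.PacketG → EvpData L H) (evpH' : 𝔰.PacketH → EvpData L H) (ramG' : 𝔰.PacketG → Finset (Places L)) (ramH' : 𝔰.PacketH → Finset (Places L))
  (PiXi' : OneDimAutRepH L → 𝔰.PacketG) (ρXi' : OneDimAutRepH L → 𝔰.PacketH)
  (c : ℚ) (jInf dsInf : ℤ → ℤ → ℤ → Cinf)
  (archTr : Cinf → (UnitaryGroup.arch (↥(maximalRealSubfield L)) L (IsCMField.complexConj L) 3 H → ℂ) → ℂ)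
  (ν : Measure (Gp L H).Adelic) [IsFiniteMeasureOnCompacts ν]
  (ramCls₀ : DiscreteAutomorphicRep (Gp L H) μ → Set (Places L))

/-- **Row #20 — law `XiFamilyFin μω hμu` AT `𝔠₀`, a THEOREM**: the finite packets of record form a ξ-local family (★ `isXiLocalFamily_xiPacketFamilyOfRecord`; the
frame terms of v6 `XiFamilyFin` match `hH hHd` by proof irrelevance). [cite: Rogawski1990, §13.1 Prop. 13.1.3 (d) p. 199; §12.2 (2) pp. 173–174] -/
theorem xiFamilyFin_kitOfRecord :
    (kitOfRecord L H ι T hT μ 𝔰 gh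
      (xiSideOfRecord L H hH hHd μω hμu Δ mH mG νG νH ξloc μZ keys hCM hexc μv evpG' evpH' ramG' ramH' PiXi' ρXi')
      μω c jInf dsInf archTr ν μv ramCls₀).XiFamilyFin μω hμu := by
  letI : ∀ v : HeightOneSpectrum (𝓞 ↥(maximalRealSubfield L)), MeasurableSpace ((cmDatum L 3 H).Local v) := fun _ => borel _
  exact isXiLocalFamily_xiPacketFamilyOfRecord L H hH hHd μω hμu Δ mH mG νG νH ξloc μZ keys hCM

/-- **Row #21 — law `XiUnram` AT `𝔠₀`** (any `hexc`), given that the kit's measures `μv v` are Haar (pin (iii) data): off `ram₀ ξ` the member `πⁿ` of record is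
`K_v`-spherical WITH `tXi₀ ξ v` and admissible (★ `xiUnram_xiEvpOfRecord`). [cite: Rogawski1990, §12.2 pp. 173–174; §13.7 p. 206] [cite: CartierCorvallis1979, §IV.1 Cor. 4.1] -/
theorem xiUnram_kitOfRecord
    (hμv : ∀ v : Places L, letI : MeasurableSpace ((cmDatum L 3 H).Local v) := borel _; (μv v).IsHaarMeasure) :
    (kitOfRecord L H ι T hT μ 𝔰 gh
      (xiSideOfRecord L H hH hHd μω hμu Δ mH mG νG νH ξloc μZ keys hCM hexc μv evpG' evpH' ramG' ramH' PiXi' ρXi')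
      μω c jInf dsInf archTr ν μv ramCls₀).XiUnram := by
  intro ξ v hv
  letI : ∀ v : HeightOneSpectrum (𝓞 ↥(maximalRealSubfield L)), MeasurableSpace ((cmDatum L 3 H).Local v) := fun _ => borel _
  haveI : BorelSpace ((cmDatum L 3 H).Local v) := ⟨rfl⟩
  haveI : (μv v).IsHaarMeasure := hμv v
  exact xiUnram_xiEvpOfRecord L H hH hHd μω hμu Δ mH mG νG νH ξloc μZ keys hCM μv ξ (hexc := hexc ξ) v hv

/-- **Row #23 — law `EvpConvention` AT `𝔠₀`**: the ξ-conjunct is a THEOREM (★ `evpConvention_xi_xiEvpOfRecord`: `tXi₀ ξ v f = 0` off `C_c(K_v\G′_v/K_v)`); the two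
packet-side junk clauses on the (J2) parameters `evpG evpH` are hypotheses (P3a pins at K9). [cite: Rogawski1990, §13.7 p. 206] [cite: CartierCorvallis1979, §IV.1 Cor. 4.1] -/
theorem evpConvention_kitOfRecord
    (hG : ∀ (Q : 𝔰.PacketG) (v : Places L) (f : (cmDatum L 3 H).Local v → ℂ),
      ¬ (HasCompactSupport f ∧ IsLevel (cmLocalIntegralLevel L 3 H v) f) → evpG' Q v f = 0)
    (hH' : ∀ (ρ : 𝔰.PacketH) (v : Places L) (f : (cmDatum L 3 H).Local v → ℂ),
      ¬ (HasCompactSupport f ∧ IsLevel (cmLocalIntegralLevel L 3 H v) f) → evpH' ρ v f = 0) :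
    (kitOfRecord L H ι T hT μ 𝔰 gh
      (xiSideOfRecord L H hH hHd μω hμu Δ mH mG νG νH ξloc μZ keys hCM hexc μv evpG' evpH' ramG' ramH' PiXi' ρXi')
      μω c jInf dsInf archTr ν μv ramCls₀).EvpConvention := by
  letI : ∀ v : HeightOneSpectrum (𝓞 ↥(maximalRealSubfield L)), MeasurableSpace ((cmDatum L 3 H).Local v) := fun _ => borel _
  exact ⟨hG, hH', evpConvention_xi_xiEvpOfRecord L H hH hHd μω hμu Δ mH mG νG νH ξloc μZ keys hCM μv⟩

end Laws

/-! ## §4 Row #21 with the letter (L-i′) BY NAME -/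

section Letter

variable [∀ v : HeightOneSpectrum (𝓞 ↥(maximalRealSubfield L)), BorelSpace (Gqs L v ⧸ Subgroup.center (Gqs L v))]
  [∀ v : HeightOneSpectrum (𝓞 ↥(maximalRealSubfield L)), (μZ v).IsHaarMeasure]
  (hquad : ∀ v : HeightOneSpectrum (𝓞 ↥(maximalRealSubfield L)), (∀ w : PlacesOver L v, IsCMField.complexConj L • w.1 = w.1) →
    IsQuadraticCharExtension (conjLocal L (IsCMField.complexConj L) v) (μω.semilocalComponent L v))
  (ι : L →+* ℂ) (T : GL (Fin 3) ℂ)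
  (hT : (T : Matrix (Fin 3) (Fin 3) ℂ)ᴴ * H.map ι * (T : Matrix (Fin 3) (Fin 3) ℂ) = Literature.Geometry.ComplexHyperbolic.BallModel.J)
  (μ : Measure (Gp L H).automorphicQuotient) [(Gp L H).IsAutomorphicMeasure μ]
  [MeasurableSpace (Gp L H).Adelic] [BorelSpace (Gp L H).Adelic]
  (𝔰 : Sockets L H μ) (gh : GHSide L H ι T hT 𝔰.PacketG 𝔰.PacketH)
  (evpG' : 𝔰.PacketG → EvpData L H) (evpH' : 𝔰.PacketH → EvpData L H) (ramG' : 𝔰.PacketG → Finset (Places L)) (ramH' : 𝔰.PacketH → Finset (Places L))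
  (PiXi' : OneDimAutRepH L → 𝔰.PacketG) (ρXi' : OneDimAutRepH L → 𝔰.PacketH)
  (c : ℚ) (jInf dsInf : ℤ → ℤ → ℤ → Cinf)
  (archTr : Cinf → (UnitaryGroup.arch (↥(maximalRealSubfield L)) L (IsCMField.complexConj L) 3 H → ℂ) → ℂ)
  (ν : Measure (Gp L H).Adelic) [IsFiniteMeasureOnCompacts ν]
  (ramCls₀ : DiscreteAutomorphicRep (Gp L H) μ → Set (Places L))

/-- **Row #21 at `𝔠₀` FROM THE LETTER (L-i′)** `hLi : XiPinSphericalCofinite L` (books row #79): with `hexc₀ ξ := hexc_of_xiPinSphericalCofinite L μω hμu μZ keys hquad hLi ξ`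
(★ p820148) as the record's `hexc`, law `XiUnram` holds at `𝔠₀`. [cite: Rogawski1990, §13.3 Thm. 13.3.6 (b) p. 202; §12.2 pp. 173–174; §13.7 p. 206] -/
theorem xiUnram_kitOfRecord_of_xiPinSphericalCofinite (hLi : XiPinSphericalCofinite L)
    (hμv : ∀ v : Places L, letI : MeasurableSpace ((cmDatum L 3 H).Local v) := borel _; (μv v).IsHaarMeasure) :
    (kitOfRecord L H ι T hT μ 𝔰 gh
      (xiSideOfRecord L H hH hHd μω hμu Δ mH mG νG νH ξloc μZ keys hCM
        (fun ξ => hexc_of_xiPinSphericalCofinite L μω hμu μZ keys hquad hLi ξ) μv evpG' evpH' ramG' ramH' PiXi' ρXi')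
      μω c jInf dsInf archTr ν μv ramCls₀).XiUnram :=
  xiUnram_kitOfRecord L H hH hHd μω hμu Δ mH mG νG νH ξloc μZ keys hCM _ μv ι T hT μ 𝔰 gh evpG' evpH' ramG' ramH' PiXi' ρXi'
    c jInf dsInf archTr ν ramCls₀ hμv

end Letter

end Summit.HodgeConjecture.HodgeConjecture.Cruxes.H413.F0P3XiSideOfRecord

end
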